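import Literature.Probability.Percolation.SlabCircuitFromLinks
import Literature.Probability.Percolation.InequalitiesProofs
import Literature.Probability.Percolation.FiniteEnergy
import HarnessLib

/-!
# Newman–Tassion–Wu 2017, Theorem 3.10 — uniqueness of the crossing cluster of a strip costs one
# more disjoint crossing: `P(Rest ∖ 𝒰) ≤ P(crossing)² · P(Rest)` by the BK inequality

Topic: `Literature/Probability/Percolation`. Fourth file of the port of THEOREM 3.10 of
Newman–Tassion–Wu, *Critical percolation and the minimal spanning tree in slabs* (CPAM 70 (2017);
arXiv:1512.09107).  Printed argument (p. 13): "observe that the occurrence of the event `ℰ₀ ∖ 𝒰₁`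
implies the existence of two disjoint open paths from `B(S₁)` to `R(S₁)` inside `S₁` … Using first
independence and then the BK inequality … `P[ℰ₀ ∖ 𝒰₁] ≤ P[S₁ crossed by two disjoint open paths]
· P[L(S₂) ⟷^{S₂} T(S₂)] ≤ P[B(S₁) ⟷^{S₁} R(S₁)]² · P[…]`."  In the tree's vocabulary the
uniqueness event is `NTW17.linked k X E₁ E₂` (`SlabCircuitFromLinks.lean`): any two vertices joined
inside `X̄` to both ends `Ē₁`, `Ē₂` are joined inside `X̄` to each other.  This file proves:

* **`NTW17.mem_disjointOccurrence_of_not_linked`** — if `linked` fails then the crossing event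
  `X ∩ E₁ ⟷^X E₂` OCCURS DISJOINTLY TWICE (`slabConn k X E₁ E₂ □ slabConn k X E₁ E₂`): the two
  unjoined vertices lie in different open clusters of `X̄`, each containing an open crossing, and
  crossings in different clusters are vertex-, hence edge-disjoint.
* **`NTW17.real_disjointOccurrence_inter_le`** — "first independence and then BK": for a finite
  strip `X` and an event `Rest` determined by edges off `X̄`,
  `P[(H □ H) ∩ Rest] ≤ P[H]² · P[Rest]`, `H` the crossing event.
* **`NTW17.real_inter_compl_linked_le`** — the combination
  `P[Rest ∖ linked] ≤ P[X crossed]² · P[Rest]` (NTW's display (3.72) in abstract form).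

## Sources

* C. M. Newman, V. Tassion, W. Wu, *Critical percolation and the minimal spanning tree in slabs*,
  Comm. Pure Appl. Math. 70 (2017) 2084–2120, arXiv:1512.09107: proof of Theorem 3.10, the events
  `𝒰₁, 𝒰₂` and the displays (3.66)–(3.72) (p. 13) [NewmanTassionWu2017].
* G. Grimmett, *Percolation*, 2nd ed. 1999, §2.3 (BK inequality; the tree's `bk_inequality_holds`)
  [GrimmettPercolation1999].
-/

noncomputable section

namespace Literature.Probability.Percolation

open MeasureTheory LatticeModels
open scoped LatticeModels

namespace NTW17

variable {k : ℕ}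

/-! ## Failure of uniqueness gives two disjoint crossings -/

/-- The set of `ω`-open edges joining two vertices of the list `l` (a witness set for "the path `l`
is open"). [cite: NewmanTassionWu2017, Theorem 3.10 (proof, "two disjoint open paths")] -/
def pathEdges (ω : BondConfig (slab 3 k)) (l : List (slab 3 k)) : Set (Sym2 (slab 3 k)) :=
  {e | e ∈ ω ∧ ∃ a ∈ l, ∃ b ∈ l, e = s(a, b)}

/-- The witness set lies in `ω`. [cite: NewmanTassionWu2017, Theorem 3.10 (proof)] -/
theorem pathEdges_subset (ω : BondConfig (slab 3 k)) (l : List (slab 3 k)) : pathEdges ω l ⊆ ω :=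
  fun _ h => h.1

/-- A configuration agreeing with `ω` on the witness set of an `ω`-open crossing path contains that
crossing: the local cylinder lies in the crossing event. [cite: NewmanTassionWu2017, Theorem 3.10 (proof)] -/
theorem localCylinder_pathEdges_subset_slabConn {ω : BondConfig (slab 3 k)} {X E₁ E₂ : Set (ℤ × ℤ)}
    {l : List (slab 3 k)} (hl : IsOSAP k ω (slabLift k X) (slabLift k E₁) (slabLift k E₂) l) :
    localCylinder (pathEdges ω l) ω ⊆ slabConn k X E₁ E₂ := by
  intro ω' hω'
  rw [mem_slabConn_iff_exists_isOSAP]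
  refine ⟨l, hl.of_edges fun a ha b hb hab => ?_⟩
  exact (hω' _ ⟨hab, a, ha, b, hb, rfl⟩).2 hab

/-- Witness sets of vertex-disjoint paths are disjoint. [cite: NewmanTassionWu2017, Theorem 3.10 (proof, "two disjoint open paths")] -/
theorem disjoint_pathEdges {ω : BondConfig (slab 3 k)} {l l' : List (slab 3 k)}
    (h : ∀ x ∈ l, x ∉ l') : Disjoint (pathEdges ω l) (pathEdges ω l') := by
  rw [Set.disjoint_left]
  rintro e ⟨-, a, ha, b, hb, rfl⟩ ⟨-, a', ha', b', hb', he⟩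
  rcases Sym2.eq_iff.1 he with ⟨rfl, -⟩ | ⟨rfl, -⟩
  · exact h a ha ha'
  · exact h a ha hb'

/-- **Failure of uniqueness ⟹ two disjoint crossings.**  If `ω ∉ linked k X E₁ E₂` — two vertices
`u, v`, each joined inside `X̄` to both `Ē₁` and `Ē₂`, are not joined inside `X̄` — then the
crossing event `slabConn k X E₁ E₂` occurs disjointly twice.
[cite: NewmanTassionWu2017, Theorem 3.10 (proof, "ℰ₀ ∖ 𝒰₁ implies the existence of two disjoint open paths")] -/
theorem mem_disjointOccurrence_of_not_linked {ω : BondConfig (slab 3 k)} {X E₁ E₂ : Set (ℤ × ℤ)}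
    (h : ω ∉ linked k X E₁ E₂) : ω ∈ slabConn k X E₁ E₂ □ slabConn k X E₁ E₂ := by
  simp only [linked, Set.mem_setOf_eq, not_forall, exists_prop] at h
  obtain ⟨u, v, ⟨e₁, he₁, hue₁⟩, ⟨e₂, he₂, hue₂⟩, ⟨f₁, hf₁, hvf₁⟩, ⟨f₂, hf₂, hvf₂⟩, huv⟩ := h
  -- open self-avoiding crossings inside the clusters of `u` and of `v`
  obtain ⟨P, hP⟩ := exists_isOSAP_of_openConnIn (SlabCriticality.openConnIn_trans (openConnIn_reverse hue₁) hue₂)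
  obtain ⟨Q, hQ⟩ := exists_isOSAP_of_openConnIn (SlabCriticality.openConnIn_trans (openConnIn_reverse hvf₁) hvf₂)
  have hPu : ∀ x ∈ P, ω ∈ openConnIn (slabLift k X) u x := fun x hx => by
    have h1 := hP.openConnIn_of_mem hx
    rw [hP.head_mem hP.ne_nil] at h1
    exact SlabCriticality.openConnIn_trans hue₁ h1
  have hQv : ∀ x ∈ Q, ω ∈ openConnIn (slabLift k X) v x := fun x hx => by
    have h1 := hQ.openConnIn_of_mem hx
    rw [hQ.head_mem hQ.ne_nil] at h1
    exact SlabCriticality.openConnIn_trans hvf₁ h1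
  -- they are vertex-disjoint
  have hdisj : ∀ x ∈ P, x ∉ Q := fun x hxP hxQ =>
    huv (SlabCriticality.openConnIn_trans (hPu x hxP) (openConnIn_reverse (hQv x hxQ)))
  -- as crossings from `Ē₁` to `Ē₂`
  have hP' : IsOSAP k ω (slabLift k X) (slabLift k E₁) (slabLift k E₂) P :=
    ⟨hP.nodup, hP.chain, hP.subset, hP.ne_nil, fun h => by rw [hP.head_mem h]; exact he₁,
      fun h => by rw [hP.last_mem h]; exact he₂⟩
  have hQ' : IsOSAP k ω (slabLift k X) (slabLift k E₁) (slabLift k E₂) Q :=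
    ⟨hQ.nodup, hQ.chain, hQ.subset, hQ.ne_nil, fun h => by rw [hQ.head_mem h]; exact hf₁,
      fun h => by rw [hQ.last_mem h]; exact hf₂⟩
  exact ⟨pathEdges ω P, pathEdges ω Q, disjoint_pathEdges hdisj,
    localCylinder_pathEdges_subset_slabConn hP', localCylinder_pathEdges_subset_slabConn hQ'⟩

/-! ## First independence, then BK -/

/-- **"First independence and then the BK inequality"**: for a finite region `X` and an event
`Rest` determined by a set of edges disjoint from the edges inside `X̄`, with `H = slabConn k X E₁ E₂`,
`P[(H □ H) ∩ Rest] ≤ P[H]² · P[Rest]`.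
[cite: NewmanTassionWu2017, Theorem 3.10 (proof, eq. (3.72))] -/
theorem real_disjointOccurrence_inter_le (p : unitInterval) {X E₁ E₂ : Set (ℤ × ℤ)} (hX : X.Finite)
    {Rest : Set (BondConfig (slab 3 k))} {T : Set (Sym2 (slab 3 k))} (hRest : DeterminedBy Rest T)
    (hRestm : MeasurableSet Rest) (hT : Disjoint (Set.sym2 (slabLift k X)) T) :
    (bondPercolation (slabGraph 3 k) p).real
        ((slabConn k X E₁ E₂ □ slabConn k X E₁ E₂) ∩ Rest) ≤
      (bondPercolation (slabGraph 3 k) p).real (slabConn k X E₁ E₂) ^ 2 *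
        (bondPercolation (slabGraph 3 k) p).real Rest := by
  set P := bondPercolation (slabGraph 3 k) p
  set H := slabConn k X E₁ E₂ with hH
  have hHdet : DeterminedBy H (Set.sym2 (slabLift k X)) := determinedBy_slabConn k E₁ E₂ subset_rfl
  have hHloc : IsLocalEvent H := by
    -- (also `NTW17.isLocalEvent_slabConn` in `SlabRSWLemma316.lean`, a heavy import)
    refine ⟨(finite_sym2 (slabLift_finite k hX)).toFinset, ?_⟩
    rw [Set.Finite.coe_toFinset]; exact hHdet
  have hHup : IsUpperSet H := isUpperSet_openCrossing _ _ _
  have hHHdet : DeterminedBy (H □ H) (Set.sym2 (slabLift k X)) := hHdet.disjointOccurrence hHdet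
  have hHHloc : IsLocalEvent (H □ H) := by
    refine ⟨(finite_sym2 (slabLift_finite k hX)).toFinset, ?_⟩
    rw [Set.Finite.coe_toFinset]; exact hHHdet
  have hHHm : MeasurableSet (H □ H) := measurableSet_of_isLocalEvent_holds hHHloc
  rw [bondPercolation_real_inter_of_disjoint (slabGraph 3 k) p hT hHHdet hRest hHHm hRestm, sq]
  exact mul_le_mul_of_nonneg_right (bk_inequality_holds (slabGraph 3 k) p hHup hHup hHloc hHloc)
    measureReal_nonneg

/-- **Uniqueness costs one more disjoint crossing** (NTW (3.72) in abstract form): for a finite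
region `X` and an event `Rest` determined by edges off `X̄`,
`P[Rest ∖ linked k X E₁ E₂] ≤ P[slabConn k X E₁ E₂]² · P[Rest]`.
[cite: NewmanTassionWu2017, Theorem 3.10 (proof, (3.66)–(3.72))] -/
theorem real_inter_compl_linked_le (p : unitInterval) {X E₁ E₂ : Set (ℤ × ℤ)} (hX : X.Finite)
    {Rest : Set (BondConfig (slab 3 k))} {T : Set (Sym2 (slab 3 k))} (hRest : DeterminedBy Rest T)
    (hRestm : MeasurableSet Rest) (hT : Disjoint (Set.sym2 (slabLift k X)) T) :
    (bondPercolation (slabGraph 3 k) p).real (Rest ∩ (linked k X E₁ E₂)ᶜ) ≤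
      (bondPercolation (slabGraph 3 k) p).real (slabConn k X E₁ E₂) ^ 2 *
        (bondPercolation (slabGraph 3 k) p).real Rest := by
  refine le_trans (measureReal_mono ?_) (real_disjointOccurrence_inter_le p hX hRest hRestm hT)
  rintro ω ⟨hR, hU⟩
  exact ⟨mem_disjointOccurrence_of_not_linked hU, hR⟩

end NTW17

end Literature.Probability.Percolation

end
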